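import Literature.Barriers.ValiantsHypothesis.BDGIL24GelfandTsetlinComponents
import Literature.Barriers.ValiantsHypothesis.BDGIL24IsotypicUniqueness
import HarnessLib

/-!
# The Gelfand–Tsetlin (`T`-isotypic) components of the space of metapolynomials are independent
# and exhaustive — "the projection onto the `T`-isotypic space" of [BDGIL24, Thm. 1.1 (4)] is
# well defined (`BergEtAl2024.gtComponent_unique`, `BergEtAl2024.thm_1_1_gt_forall`)

Theorem-only companion of `BDGIL24GelfandTsetlinComponents.lean` (val-lit row vdBDGIL24-A; M. van
den Berg, P. Dutta, F. Gesmundo, C. Ikenmeyer, V. Lysikov, *Algebraic metacomplexity and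
representation theory*, arXiv:2411.03444 [BergEtAl2024]). There, "the projection of `Δ` onto the
`T`-isotypic space" of Thm. 1.1 (4) is typed (`thm_1_1_gt`) by the characterisation `Δ' ∈ V_T`,
`Δ − Δ' ∈ ⨆_{T' ≠ T} V_{T'}` with `V_T = gtSubspace (coordRep (Fin k) ℂ d) T`, and proved
(`thm_1_1_gt_holds`) for SOME such `Δ'`. This file shows that the characterisation pins `Δ'`
down and that the `V_T` decompose the whole space, exactly as was done for items (1)–(3) in
`BDGIL24IsotypicUniqueness.lean`:

* `gtSubspace_finset_independent_aux`, **`iSupIndep_gtSubspace`** — for a LOCALLY FINITE rational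
  representation of `GL_k` (characteristic `0`) the components `V_T = ⋂_j B^{(j)}_{T_j}`
  (`B^{(j)}_μ` = the `μ`-isotypic component of the restriction to `diag(GL_j, 1)`) are
  independent: by induction on the level `n`, a vanishing finite sum `∑_T y_T` of vectors
  `y_T ∈ V_T` whose chains agree above level `n` is grouped by the weight at level `n`; the
  partial sums lie in distinct `B^{(n)}_μ`, which are independent
  (`iSupIndep_hwSubrep_of_locallyFinite` for the rational, locally finite restriction:
  `isRationalRep_comp_glLift`, `locallyFinite_comp`), and inside a fibre the chains agree above
  level `n - 1`;
* `iSup_gtSubspace_eq_top` — they are exhaustive (every vector lies in a finite-dimensional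
  subrepresentation, which is the sum of its intersections with the `V_T`:
  `le_iSup_inf_gtSubspace` of the companion file);
* `iSupIndep_gtSubspace_coordRep`, **`gtComponent_unique`**, **`thm_1_1_gt_forall`**,
  `thm_1_1_gt_sharp_forall`, **`isInternal_gtSubspace_coordRep`** — for the metapolynomial
  representation `coordRep (Fin k) ℂ d` (locally finite: `exists_subrepresentation_coordRep_mem`):
  THE `T`-isotypic projection is unique, the `cc` bound of Thm. 1.1 (4) (`C = 6`, and the sharp
  `(δd+1)^{k²}(s+2)`) holds for it, and the space of format-`(*, d, k)` metapolynomials is the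
  DIRECT SUM `⊕_T V_T` ([BDGIL24, §1 p.4–5; §4.5 eq. (13)]);
* **`hwSubrep_coordRep_eq_iSup_gtSubspace`** — the Gelfand–Tsetlin decomposition REFINES the
  isotypic one: the `λ`-isotypic component is `⨆_{T : T_k = λ} V_T` ("Each `λ`-isotypic component
  decomposes even further into a direct sum of subspaces with one summand for each semistandard
  tableau `T` of shape `λ`", p0005.txt:L5–L7).

No definitions, no named facts. NOT here: "each `T`-isotypic component of an irreducible `V` is
1-dimensional" (multiplicity-free branching `GL_k ↓ GL_{k-1}`, §4.5) — not needed for Thm. 1.1 (4).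
Honest framing: representation-theoretic bookkeeping; nothing here bears on `VP ≠ VNP`.

## References
* [BergEtAl2024] arXiv:2411.03444, §1 (p.4–5), Thm. 1.1 (4), §4.5 eq. (12)–(13) (p.22, PDF p.23).
* [GoodmanWallachGTM255] R. Goodman, N. Wallach, *Symmetry, Representations, and Invariants*,
  §4.1.6 (isotypic decomposition), §8.1 (branching to `GL_{n-1}`, Gelfand–Tsetlin).
-/

noncomputable section

open MvPolynomial


namespace Literature.Barriers.ValiantsHypothesis

namespace BergEtAl2024

open Literature.Computability.AlgebraicComplexity Literature.NumberTheory.DiophantineGeometry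
open scoped BigOperators

section Independence

variable {K V : Type*} [Field K] [AddCommGroup V] [Module K V] {k : ℕ}

/-- Independence, finite form: in an independent family of subspaces, a vanishing finite sum of
members has all terms zero (the finite test behind "direct sum", cf.
`iSupIndep_of_finset_sum_eq_zero`). [cite: GoodmanWallachGTM255, §4.1.6 (isotypic decomposition: direct sum)] -/
theorem eq_zero_of_iSupIndep_of_sum_eq_zero {ι : Type*} {q : ι → Submodule K V}
    (hq : iSupIndep q) (S : Finset ι) (z : ι → V) (hz : ∀ c ∈ S, z c ∈ q c)
    (hsum : ∑ c ∈ S, z c = 0) : ∀ c ∈ S, z c = 0 := by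
  classical
  intro c₀ hc₀
  have hd := hq c₀
  rw [Submodule.disjoint_def] at hd
  refine hd _ (hz c₀ hc₀) ?_
  have h0 : z c₀ = -∑ c ∈ S.erase c₀, z c := by
    rw [← Finset.add_sum_erase S z hc₀] at hsum
    exact eq_neg_of_add_eq_zero_left hsum
  rw [h0]
  refine Submodule.neg_mem _ (Submodule.sum_mem _ fun c hc => ?_)
  obtain ⟨hne, hcS⟩ := Finset.mem_erase.1 hc
  exact Submodule.mem_iSup_of_mem c (Submodule.mem_iSup_of_mem hne (hz c hcS))

/-- The `T`-isotypic component lies in the level-`j` isotypic component of type `T j`.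
[cite: BergEtAl2024, §4.5, p.22 (PDF p.23)] locator: paper:arxiv-2411.03444 p0023.txt:L40–L47 -/
theorem gtSubspace_le_level (ρ : Representation K (GL (Fin k) K) V) (T : GTPattern k)
    (j : Fin (k + 1)) : gtSubspace ρ T ≤ hwSubrep (ρ.comp (glLift (level_le j))) (T j) :=
  iInf_le _ j

/-- **Independence of the Gelfand–Tsetlin components, finite form by levels.** For a locally
finite rational representation of `GL_k` (characteristic `0`) and `n ≤ k + 1`: if finitely many
chains `T ∈ F` pairwise agree at all levels `≥ n`, and `y_T ∈ V_T` with `∑_{T ∈ F} y_T = 0`, then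
all `y_T = 0` — induction on `n`, grouping the terms by the weight at level `n` (independence of
the isotypic components of the rational restriction to `diag(GL_n, 1)`,
`iSupIndep_hwSubrep_of_locallyFinite`). [cite: BergEtAl2024, §4.5 eq. (13), p.22 (PDF p.23)] locator: paper:arxiv-2411.03444 p0023.txt:L48–L53 -/
theorem gtSubspace_finset_independent_aux [CharZero K] {ρ : Representation K (GL (Fin k) K) V}
    (hρ : IsRationalRep ρ)
    (hlf : ∀ v : V, ∃ U : Subrepresentation ρ, v ∈ U.toSubmodule ∧ FiniteDimensional K U.toSubmodule) :
    ∀ n : ℕ, n ≤ k + 1 → ∀ (F : Finset (GTPattern k)) (y : GTPattern k → V),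
      (∀ T ∈ F, ∀ T' ∈ F, ∀ j : Fin (k + 1), n ≤ (j : ℕ) → T j = T' j) →
      (∀ T ∈ F, y T ∈ gtSubspace ρ T) → ∑ T ∈ F, y T = 0 → ∀ T ∈ F, y T = 0 := by
  classical
  intro n
  induction n with
  | zero =>
    intro _ F y hagree hy hsum T hT
    -- all chains in `F` coincide
    have hF : ∀ T' ∈ F, T' = T := fun T' hT' =>
      funext fun j => hagree T' hT' T hT j (Nat.zero_le _)
    have hsum' : ∑ T' ∈ F, y T' = y T := by
      rw [Finset.sum_eq_single_of_mem T hT]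
      intro T' hT' hne
      exact absurd (hF T' hT') hne
    rw [← hsum', hsum]
  | succ n ih =>
    intro hn F y hagree hy hsum T hT
    have hnk : n ≤ k := by omega
    set j₀ : Fin (k + 1) := ⟨n, Nat.lt_succ_of_le hnk⟩ with hj₀
    -- group the terms by the weight at level `n`
    set z : Weight (Fin n) → V := fun c => ∑ T' ∈ F with T' j₀ = c, y T' with hz
    have hzmem : ∀ c ∈ F.image (fun T' => T' j₀), z c ∈ hwSubrep (ρ.comp (glLift hnk)) c := by
      intro c _
      refine Submodule.sum_mem _ fun T' hT' => ?_
      obtain ⟨hT'F, hT'c⟩ := Finset.mem_filter.1 hT'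
      have h := gtSubspace_le_level ρ T' j₀ (hy T' hT'F)
      rw [hT'c] at h
      exact h
    have hzsum : ∑ c ∈ F.image (fun T' => T' j₀), z c = 0 := by
      rw [hz, Finset.sum_fiberwise_of_maps_to (fun T' hT' => Finset.mem_image_of_mem _ hT')]
      exact hsum
    have hind : iSupIndep fun μ => hwSubrep (ρ.comp (glLift hnk)) μ :=
      iSupIndep_hwSubrep_of_locallyFinite (isRationalRep_comp_glLift hρ hnk)
        (locallyFinite_comp hlf _)
    have hz0 := eq_zero_of_iSupIndep_of_sum_eq_zero hind _ z hzmem hzsum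
    -- within the fibre of `T`, the chains agree at all levels `≥ n`: induction hypothesis
    set Fc := F.filter fun T' => T' j₀ = T j₀ with hFc
    have hTFc : T ∈ Fc := Finset.mem_filter.2 ⟨hT, rfl⟩
    refine ih (by omega) Fc y ?_ (fun T' hT' => hy T' (Finset.mem_filter.1 hT').1) ?_ T hTFc
    · intro T₁ hT₁ T₂ hT₂ j hj
      obtain ⟨hT₁F, hT₁c⟩ := Finset.mem_filter.1 hT₁
      obtain ⟨hT₂F, hT₂c⟩ := Finset.mem_filter.1 hT₂
      rcases Nat.lt_or_eq_of_le hj with hlt | heq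
      · exact hagree T₁ hT₁F T₂ hT₂F j hlt
      · have hjj : j = j₀ := Fin.ext heq.symm
        subst hjj
        rw [hT₁c, hT₂c]
    · exact hz0 (T j₀) (Finset.mem_image_of_mem _ hT)

/-- **The Gelfand–Tsetlin components `V_T` of a locally finite rational representation of `GL_k`
(characteristic `0`) are independent**: `⨆_T V_T` is a direct sum.
[cite: BergEtAl2024, §1 ("each `λ`-isotypic component decomposes even further into a direct sum"), p.4 (PDF p.5)] locator: paper:arxiv-2411.03444 p0005.txt:L5–L7 -/
theorem iSupIndep_gtSubspace [CharZero K] {ρ : Representation K (GL (Fin k) K) V}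
    (hρ : IsRationalRep ρ)
    (hlf : ∀ v : V, ∃ U : Subrepresentation ρ, v ∈ U.toSubmodule ∧ FiniteDimensional K U.toSubmodule) :
    iSupIndep fun T => gtSubspace ρ T :=
  iSupIndep_of_finset_sum_eq_zero _ fun F y hy hsum =>
    gtSubspace_finset_independent_aux hρ hlf (k + 1) le_rfl F y
      (fun _ _ _ _ j hj => absurd hj (not_le.2 j.2)) hy hsum

/-- From independence: the characterisation "`x' ∈ V_T` and `x − x' ∈ ⨆_{T' ≠ T} V_{T'}`"
determines `x'`. [cite: BergEtAl2024, Thm. 1.1 (4), p.4 (PDF p.5)] -/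
theorem eq_of_iSupIndep_gtSubspace {ρ : Representation K (GL (Fin k) K) V}
    (hind : iSupIndep fun T => gtSubspace ρ T) {T : GTPattern k} {x x₁ x₂ : V}
    (h₁ : x₁ ∈ gtSubspace ρ T) (h₁' : x - x₁ ∈ ⨆ T' ∈ {T' : GTPattern k | T' ≠ T}, gtSubspace ρ T')
    (h₂ : x₂ ∈ gtSubspace ρ T) (h₂' : x - x₂ ∈ ⨆ T' ∈ {T' : GTPattern k | T' ≠ T}, gtSubspace ρ T') :
    x₁ = x₂ := by
  have hd := hind T
  rw [Submodule.disjoint_def] at hd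
  have hmem : x₁ - x₂ ∈ ⨆ T' ∈ {T' : GTPattern k | T' ≠ T}, gtSubspace ρ T' := by
    have : x₁ - x₂ = (x - x₂) - (x - x₁) := by abel
    rw [this]
    exact Submodule.sub_mem _ h₂' h₁'
  have hmem' : x₁ - x₂ ∈ ⨆ (T') (_ : T' ≠ T), gtSubspace ρ T' := by
    simpa only [Set.mem_setOf_eq] using hmem
  exact sub_eq_zero.1 (hd _ (Submodule.sub_mem _ h₁ h₂) hmem')

/-- **A locally finite rational representation of `GL_k` (characteristic `0`) is the sum of its
Gelfand–Tsetlin components.** [cite: BergEtAl2024, §4.5 eq. (13), p.22 (PDF p.23)] locator: paper:arxiv-2411.03444 p0023.txt:L48–L53 -/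
theorem iSup_gtSubspace_eq_top [CharZero K] {ρ : Representation K (GL (Fin k) K) V}
    (hρ : IsRationalRep ρ)
    (hlf : ∀ v : V, ∃ U : Subrepresentation ρ, v ∈ U.toSubmodule ∧ FiniteDimensional K U.toSubmodule) :
    (⨆ T, gtSubspace ρ T) = ⊤ := by
  rw [eq_top_iff]
  intro x _
  obtain ⟨U, hxU, hUfd⟩ := hlf x
  haveI := hUfd
  have h := le_iSup_inf_gtSubspace hρ U.toSubmodule (fun g y hy => U.apply_mem_toSubmodule g hy) hxU
  exact (iSup_mono fun T => (inf_le_right : U.toSubmodule ⊓ gtSubspace ρ T ≤ _)) h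

end Independence

/-! ### The metapolynomial representation `coordRep` -/

section CoordRep

variable {k d : ℕ}

/-- **The Gelfand–Tsetlin components of the space of metapolynomials are independent.**
[cite: BergEtAl2024, §1 (`T`-isotypic components), p.4 (PDF p.5)] locator: paper:arxiv-2411.03444 p0005.txt:L5–L7 -/
theorem iSupIndep_gtSubspace_coordRep (k d : ℕ) :
    iSupIndep fun T => gtSubspace (coordRep (Fin k) ℂ d) T :=
  iSupIndep_gtSubspace (isRationalRep_coordRep d) exists_subrepresentation_coordRep_mem

/-- **"The" `T`-isotypic projection of [BDGIL24, Thm. 1.1 (4)] is unique**: for a metapolynomial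
`Δ` and a chain `T`, at most one `Δ'` satisfies `Δ' ∈ V_T` and `Δ − Δ' ∈ ⨆_{T' ≠ T} V_{T'}` — the
characterisation by which the typed `thm_1_1_gt` renders "the projection of `Δ` onto the
`T`-isotypic space" therefore determines `Δ'`.
[cite: BergEtAl2024, Thm. 1.1 (4), p.4 (PDF p.5)] locator: paper:arxiv-2411.03444 p0005.txt:L83–L85 -/
theorem gtComponent_unique {T : GTPattern k} {Δ Δ₁ Δ₂ : MvPolynomial (DegIdx (Fin k) d) ℂ}
    (h₁ : Δ₁ ∈ gtSubspace (coordRep (Fin k) ℂ d) T)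
    (h₁' : Δ - Δ₁ ∈ ⨆ T' ∈ {T' : GTPattern k | T' ≠ T}, gtSubspace (coordRep (Fin k) ℂ d) T')
    (h₂ : Δ₂ ∈ gtSubspace (coordRep (Fin k) ℂ d) T)
    (h₂' : Δ - Δ₂ ∈ ⨆ T' ∈ {T' : GTPattern k | T' ≠ T}, gtSubspace (coordRep (Fin k) ℂ d) T') :
    Δ₁ = Δ₂ :=
  eq_of_iSupIndep_gtSubspace (iSupIndep_gtSubspace_coordRep k d) h₁ h₁' h₂ h₂'

/-- **Theorem 1.1 (4) for THE `T`-isotypic projection**: `thm_1_1_gt_holds` bounds `cc` of SOME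
`Δ'` with the characterising property; by `gtComponent_unique` the bound holds for EVERY such
`Δ'` — i.e. for the projection of `Δ` onto the `T`-isotypic space.
[cite: BergEtAl2024, Thm. 1.1 (4), p.4 (PDF p.5)] locator: paper:arxiv-2411.03444 p0005.txt:L83–L85 -/
theorem thm_1_1_gt_forall :
    ∃ C : ℕ, ∀ (δ d k s : ℕ) (Δ : MvPolynomial (DegIdx (Fin k) d) ℂ), 1 ≤ d → Δ.IsHomogeneous δ →
      affComplexity Δ ≤ s → ∀ (T : GTPattern k) (Δ' : MvPolynomial (DegIdx (Fin k) d) ℂ),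
        Δ' ∈ gtSubspace (coordRep (Fin k) ℂ d) T →
        Δ - Δ' ∈ ⨆ T' ∈ {T' : GTPattern k | T' ≠ T}, gtSubspace (coordRep (Fin k) ℂ d) T' →
        affComplexity Δ' ≤ C * s * k ^ (2 * k ^ 2) * (δ * d) ^ (2 * k ^ 4) := by
  obtain ⟨C, hC⟩ := thm_1_1_gt_holds
  refine ⟨C, fun δ d k s Δ hd hΔ hs T Δ' h₁ h₁' => ?_⟩
  obtain ⟨Δ₀, h₀, h₀', hcc⟩ := hC δ d k s Δ hd hΔ hs T
  rw [gtComponent_unique h₁ h₁' h₀ h₀']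
  exact hcc

/-- The sharp bound holds for THE projection: `cc ≤ (δd + 1)^{k²} (s + 2)`, and it lies in the
orbit span. [cite: BergEtAl2024, Thm. 1.1 (4), p.4 (PDF p.5)] locator: paper:arxiv-2411.03444 p0005.txt:L83–L85 -/
theorem thm_1_1_gt_sharp_forall (δ d k s : ℕ) (Δ : MvPolynomial (DegIdx (Fin k) d) ℂ)
    (hΔ : Δ.IsHomogeneous δ) (hs : affComplexity Δ ≤ s) (T : GTPattern k)
    (Δ' : MvPolynomial (DegIdx (Fin k) d) ℂ) (h₁ : Δ' ∈ gtSubspace (coordRep (Fin k) ℂ d) T)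
    (h₁' : Δ - Δ' ∈ ⨆ T' ∈ {T' : GTPattern k | T' ≠ T}, gtSubspace (coordRep (Fin k) ℂ d) T') :
    Δ' ∈ Submodule.span ℂ (Set.range fun h : GL (Fin k) ℂ => coordRep (Fin k) ℂ d h Δ) ∧
      affComplexity Δ' ≤ (δ * d + 1) ^ (k * k) * (s + 2) := by
  obtain ⟨Δ₀, h₀, h₀', hM, hcc⟩ := thm_1_1_gt_sharp δ d k s Δ hΔ hs T
  rw [gtComponent_unique h₁ h₁' h₀ h₀']
  exact ⟨hM, hcc⟩

/-- **The space of format-`(*, d, k)` metapolynomials is the DIRECT SUM of its Gelfand–Tsetlin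
components** `gtSubspace (coordRep (Fin k) ℂ d) T` (independent and exhaustive).
[cite: BergEtAl2024, §1 (`T`-isotypic components) and §4.5 eq. (13), p.4, 22 (PDF p.5, 23)] locator: paper:arxiv-2411.03444 p0005.txt:L5–L7 -/
theorem isInternal_gtSubspace_coordRep (k d : ℕ) :
    DirectSum.IsInternal fun T => gtSubspace (coordRep (Fin k) ℂ d) T :=
  DirectSum.isInternal_submodule_of_iSupIndep_of_iSup_eq_top (iSupIndep_gtSubspace_coordRep k d)
    (iSup_gtSubspace_eq_top (isRationalRep_coordRep d) exists_subrepresentation_coordRep_mem)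

/-- **The Gelfand–Tsetlin decomposition refines the isotypic decomposition**: the `λ`-isotypic
component of the space of metapolynomials is the sum (direct, by `iSupIndep_gtSubspace_coordRep`)
of the `V_T` over the chains `T` with top level `λ^{(k)} = λ` ("Each `λ`-isotypic component
decomposes even further into a direct sum of subspaces with one summand for each semistandard
tableau `T` of shape `λ`").
[cite: BergEtAl2024, §1, p.4 (PDF p.5)] locator: paper:arxiv-2411.03444 p0005.txt:L5–L7 -/
theorem hwSubrep_coordRep_eq_iSup_gtSubspace (χ : Weight (Fin k)) :
    hwSubrep (coordRep (Fin k) ℂ d) χ =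
      ⨆ T ∈ {T : GTPattern k | χ = T (Fin.last k)}, gtSubspace (coordRep (Fin k) ℂ d) T := by
  refine le_antisymm ?_ (iSup₂_le fun T hT => (gtSubspace_le_hwSubrep_last _ T).trans (by
    rw [← show χ = T (Fin.last k) from hT]))
  intro x hx
  set ρ := coordRep (Fin k) ℂ d with hρ
  -- the top weight of a chain
  let top : GTPattern k → Weight (Fin k) := fun T => T (Fin.last k)
  -- decompose `x` along the (exhaustive) Gelfand–Tsetlin components
  have htop := iSup_gtSubspace_eq_top (isRationalRep_coordRep d)
    (exists_subrepresentation_coordRep_mem (k := k) (d := d))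
  have hx' : x ∈ ⨆ T, gtSubspace ρ T := by rw [htop]; exact Submodule.mem_top
  obtain ⟨f, hf, hfx⟩ := (Submodule.mem_iSup_iff_exists_finsupp _ x).1 hx'
  have hfx' : ∑ T ∈ f.support, f T = x := hfx
  -- group by the top weight: the partial sums lie in the (independent) isotypic components
  set z : Weight (Fin k) → MvPolynomial (DegIdx (Fin k) d) ℂ :=
    fun c => ∑ T ∈ f.support with top T = c, f T with hz
  have hzmem : ∀ c, z c ∈ hwSubrep ρ c := by
    intro c
    refine Submodule.sum_mem _ fun T hT => ?_
    obtain ⟨-, hTc⟩ := Finset.mem_filter.1 hT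
    have h := gtSubspace_le_hwSubrep_last ρ T (hf T)
    have hTc' : (T (Fin.last k) : Weight (Fin k)) = c := hTc
    rw [hTc'] at h
    exact h
  set S : Finset (Weight (Fin k)) := insert χ (f.support.image top) with hS
  have hzsum : ∑ c ∈ S, z c = x := by
    rw [← hfx', hz]
    exact Finset.sum_fiberwise_of_maps_to (g := top) (f := fun T => f T) fun T hT =>
      Finset.mem_insert_of_mem (Finset.mem_image_of_mem top hT)
  -- the family `z - [c = χ] x` sums to zero in the independent family of isotypic components
  set y : Weight (Fin k) → MvPolynomial (DegIdx (Fin k) d) ℂ :=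
    fun c => z c - if c = χ then x else 0 with hy
  have hymem : ∀ c ∈ S, y c ∈ hwSubrep ρ c := by
    intro c _
    refine Submodule.sub_mem _ (hzmem c) ?_
    split_ifs with h
    · rw [h]; exact hx
    · exact Submodule.zero_mem _
  have hysum : ∑ c ∈ S, y c = 0 := by
    rw [hy, Finset.sum_sub_distrib, hzsum, Finset.sum_ite_eq' S χ, if_pos (Finset.mem_insert_self _ _),
      sub_self]
  have h0 := eq_zero_of_iSupIndep_of_sum_eq_zero (iSupIndep_hwSubrep_coordRep k d) S y hymem hysum χ
    (Finset.mem_insert_self _ _)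
  have hxz : x = z χ := by
    have : z χ - x = 0 := by simpa [hy] using h0
    exact (sub_eq_zero.1 this).symm
  rw [hxz]
  refine Submodule.sum_mem _ fun T hT => ?_
  obtain ⟨-, hTc⟩ := Finset.mem_filter.1 hT
  exact Submodule.mem_iSup_of_mem T (Submodule.mem_iSup_of_mem
    (show χ = T (Fin.last k) from hTc.symm) (hf T))

end CoordRep

end BergEtAl2024

end Literature.Barriers.ValiantsHypothesis
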